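/-
Copyright: the b2b-balaban T⁴-continuum CRUX team, row NE7b owner lineage `t4-ne7b-p1` (gen 116). Project licence.
-/
import Summits.QuantumFields.BalabanUV.T4Continuum.Spine.NE7b.SupBackgroundSemigroup

/-!
# THE BACKGROUND DEPENDS LIPSCHITZ-CONTINUOUSLY ON THE POTENTIAL AND NOT AT ALL ON THE SOFT WEIGHT: for (60)'s small-field
# background on `ℓ^∞(ℤ^d)` (`d ≥ 3`, every side), two sitewise terms `u₁`, `u₂` with `|u₂ − u₁| ≤ δ` on `[−r, r]` give backgrounds with
# `‖σ₂(w) − σ₁(w)‖_∞ ≤ 2N(1 − 2λN)⁻¹·δ` on the whole chart ball, and two weights `a, a′ > 0` give THE SAME background — the term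
# `aQ′*Q′` of the site matrix is a gauge for the hard step (row NE7b, node U5c; ASE ∕ (60) ∕ (76) BY NAME; [folklore])

Cell `pub-balaban`, sub-cell `t4`, spine estimate NE7b (`T4WeightBudget.RelWeightBound`; the cell's OWN estimate — NOT PRINTED in
[Bałaban 1983–89], NOT PROVED).  Crux-route work under `Spine/NE7b/` by the row OWNER (`t4-ne7b-p1` gen 116) under FREEZE (0)'s
crux-prover clause (FILING-CLAIM C-ne7bp1-g116-7); NOTHING of Bałaban's is named, valued or asserted; no `T4Continuum/Support` leaf
typed; no `def`, no notation; zero `sorry`.  Imports (BY NAME): the owner's (76) `…SupBackgroundSemigroup` (`sum_nbhd_AX_mul`,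
`blockAvg_comp_blk`; through it (60) `exists_background`, leaf-06's (57) ASE `exists_aug_equiv_sup`, (51) `abs_blockAvg_le`, (58)
`abs_apply_le_norm`).

WHY (located).  Along the flow the sitewise term CHANGES from level to level — by the canonical rescaling ((76) ∕ the owner's tower file:
`u ↦ (ℓ+1)⁻²u`) and, in print, by the renormalisation of the effective potential ([B11] ∕ [B12]: the small-field effective densities are
re-expanded at every step); and the soft weight `a` of `Δ^η + aQ′*Q′` is a free parameter of the Gaussian normalisation ([B4] (1.5): any
`a > 0`).  Two located questions of the sup road therefore have one-screen answers from (60)'s own letters: (i) the background is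
LIPSCHITZ in the potential, uniformly on the chart ball — the difference `ψ = σ₂w − σ₁w` has `Q′ψ = 0` and `P(Aψ) = −P(u₂∘σ₂w − u₁∘σ₁w)`,
so `ψ = T⁻¹(0, P(Aψ))` (ASE) and `‖ψ‖ ≤ N·2(λ‖ψ‖ + δ)`, a bootstrap closed by (60)'s `2λ ≤ c < N⁻¹` (§1–§2); (ii) the background does
NOT depend on `a` — the `a`-term of the site matrix acts on any field as the block-constant field `a·(Q′φ)∘blk` ((76)'s row formula), so
the sitewise system for `(a′, u)` implies the one for `(a, u)` and (60)'s uniqueness identifies the two backgrounds on the common ball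
(§3).  Consequence for the tower: the constants `N(a)`, `c`, radii may be optimised in `a` level by level without changing the objects.

WHAT IS PROVED ([folklore]; `ℓ^∞ := lp (fun _ : X d => ℝ) ∞`):
* §1 `norm_fibreProj_A_sub_le` (two solutions of the sitewise systems for `u₁`, `u₂` with the same operators: `‖P(A(φ₂ − φ₁))‖ ≤ 2G`
  whenever `|u₂(φ₂ q) − u₁(φ₁ q)| ≤ G` sitewise), **`norm_sub_le_of_background_pair`** (ASE's chart with `‖T⁻¹‖ ≤ N`, `Q′φ₁ = Q′φ₂`,
  `u₂` `λ`-Lipschitz, `|u₂ − u₁| ≤ δ` on the values of `φ₁`, `2λN < 1` ⟹ `‖φ₂ − φ₁‖ ≤ (1 − 2λN)⁻¹·2N·δ`).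
* §2 **`exists_background_pair_modulus`** — `d ≥ 3`, `a > 0`, (60)'s data for `u₁` and for `u₂` with common `(λ, c, N, r)`,
  `|u₂ t − u₁ t| ≤ δ` for `|t| ≤ r` ⟹ (60)'s operators and backgrounds `σ₁`, `σ₂` with all of (60)'s letters AND, on `‖w‖ ≤ (N⁻¹ − c)r`:
  `‖σ₂ w − σ₁ w‖ ≤ (1 − 2λN)⁻¹·2N·δ` — THE BACKGROUND IS LIPSCHITZ IN THE POTENTIAL (sup over `[−r, r]`), uniformly on the chart ball.
* §3 `backgroundSystem_of_weight` (the sitewise system for `(a′, u)` implies the one for `(a, u)`, any `a, a′`, any field),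
  **`background_indep_of_weight`** (under the displayed actions at weights `a`, `a′` and `σ_a`'s uniqueness clause at radius `r`: every
  `φ`, `‖φ‖ ≤ r`, solving the `(a′, u)` system has `σ_a(Q′φ) = φ` — so `σ_a = σ_{a′}` on the common chart ball).
* §4 toy.

HONEST (what this is NOT).  Sup-norm modulus only (the potential is a global datum — no locality to exploit); no derivative-level
modulus (`Dσ` in `u`: the same bootstrap on the linearised system, not typed); `a`-independence of the BACKGROUND, not of the constants;
scalar `ℤ^d`, hard constraint; nothing of the covariant `H_k`, (A3) ∕ (A1c) (NC-NE7b-α UNRULED).  BY-NAME EFFECT ON THE WALL: NONE.  NE7b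
NOT PRINTED ∕ NOT PROVED; spine PROVED 0∕9; rung (B)+1 on a FINITE torus — NOT infinite volume, NOT the mass gap, NOT Clay.  HONEST
DEPENDENCY: continuum YM on T⁴ ⇐ BetaPertH ∧ nine spine estimates (0∕9 proved); BetaPertH ⇐ (D1) ∧ (D4) ∧ CAP+tail; G-an2-4 gates asym,
D1 and NE2∕3∕4.
-/

set_option autoImplicit false

noncomputable section

namespace Summit.QuantumFields.BalabanUV.T4Continuum.NE7b.SupBackgroundDataModulus

open scoped ENNReal NNReal
open Metric Set
open Literature.MathematicalPhysics.QuantumFieldTheory.Balaban1983to89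
open B4Sect5Proof (latticeConst latticeConst_nonneg)
open B6QGQLower276 (X e blk B mem_B sum_B_const AX)
open B6QGQDecay237 (deltaU deltaU_pos)
open B5Hk103ScalarZd (nbhd deltaH deltaH_pos)
open Summit.QuantumFields.BalabanUV.Beta.D1BFx.BlockColumnSupNorm (cHs cHs_nonneg)
open Summit.QuantumFields.BalabanUV.Beta.D1BFx.PointColumnSplit (cKL cG0 cSplit)
open Summit.QuantumFields.BalabanUV.Beta.D1BFx.PointColumnDecay (cFar)
open OneShotChartSupOperator (abs_apply_le_norm)
open FibreInverseSupNorm (abs_blockAvg_le)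
open AugmentedSupEquivalence (exists_aug_equiv_sup)
open SupSmallFieldBackground (exists_background)
open SupBackgroundSemigroup (sum_nbhd_AX_mul blockAvg_comp_blk)

variable {d : ℕ}

/-! ## §1. The bootstrap for a pair of solutions -/

section Pair

variable {n : ℕ} {Dop Aop Pop : lp (fun _ : X d => ℝ) ∞ →L[ℝ] lp (fun _ : X d => ℝ) ∞}

/-- **`‖P(A(φ₂ − φ₁))‖ ≤ 2G` FOR TWO SOLUTIONS OF THE SITEWISE SYSTEMS** (potentials `u₁`, `u₂`; `|u₂(φ₂ q) − u₁(φ₁ q)| ≤ G` sitewise):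
`P(A(φ₂ − φ₁))(q) = Q′(u₂∘φ₂ − u₁∘φ₁)(blk q) − (u₂(φ₂ q) − u₁(φ₁ q))`. [folklore] -/
theorem norm_fibreProj_A_sub_le
    (hP : ∀ (f : lp (fun _ : X d => ℝ) ∞) (p : X d), Pop f p = f p - (((n : ℝ) + 1) ^ d)⁻¹ * ∑ p' ∈ B n (blk n p), f p')
    {u₁ u₂ : ℝ → ℝ} {φ₁ φ₂ : lp (fun _ : X d => ℝ) ∞}
    (h₁ : ∀ p : X d, Aop φ₁ p + u₁ (φ₁ p) = (((n : ℝ) + 1) ^ d)⁻¹ * ∑ p' ∈ B n (blk n p), (Aop φ₁ p' + u₁ (φ₁ p')))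
    (h₂ : ∀ p : X d, Aop φ₂ p + u₂ (φ₂ p) = (((n : ℝ) + 1) ^ d)⁻¹ * ∑ p' ∈ B n (blk n p), (Aop φ₂ p' + u₂ (φ₂ p')))
    {G : ℝ} (hG : ∀ q, |u₂ (φ₂ q) - u₁ (φ₁ q)| ≤ G) : ‖Pop (Aop (φ₂ - φ₁))‖ ≤ 2 * G := by
  have hG0 : 0 ≤ G := (abs_nonneg _).trans (hG 0)
  refine lp.norm_le_of_forall_le (by positivity) fun q => ?_
  have hq : Pop (Aop (φ₂ - φ₁)) q
      = (((n : ℝ) + 1) ^ d)⁻¹ * ∑ p' ∈ B n (blk n q), (u₂ (φ₂ p') - u₁ (φ₁ p')) - (u₂ (φ₂ q) - u₁ (φ₁ q)) := by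
    rw [hP, map_sub]
    simp only [lp.coeFn_sub, Pi.sub_apply, Finset.sum_sub_distrib, mul_sub]
    have e₁ := h₁ q
    have e₂ := h₂ q
    rw [Finset.sum_add_distrib, mul_add] at e₁ e₂
    linarith
  rw [Real.norm_eq_abs, hq]
  calc _ ≤ |(((n : ℝ) + 1) ^ d)⁻¹ * ∑ p' ∈ B n (blk n q), (u₂ (φ₂ p') - u₁ (φ₁ p'))| + |u₂ (φ₂ q) - u₁ (φ₁ q)| := abs_sub _ _
    _ ≤ G + G := add_le_add (abs_blockAvg_le n (fun p' => hG p') (blk n q)) (hG q)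
    _ = 2 * G := by ring

/-- **THE BOOTSTRAP**: with ASE's chart `T h = (Q′h, P(Ah))`, `‖T⁻¹ y‖ ≤ N‖y‖`, two fields with the SAME block means solving the
sitewise systems for `u₁`, `u₂`, `u₂` `λ`-Lipschitz, `|u₂(φ₁ q) − u₁(φ₁ q)| ≤ δ` sitewise and `2λN < 1`:
`‖φ₂ − φ₁‖ ≤ (1 − 2λN)⁻¹·2N·δ` — because `φ₂ − φ₁ = T⁻¹(0, P(A(φ₂ − φ₁)))` and §1. [folklore] -/
theorem norm_sub_le_of_background_pair
    (hP : ∀ (f : lp (fun _ : X d => ℝ) ∞) (p : X d), Pop f p = f p - (((n : ℝ) + 1) ^ d)⁻¹ * ∑ p' ∈ B n (blk n p), f p')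
    (Rop : lp (fun _ : X d => ℝ) ∞ →L[ℝ] Dop.ker) (hR : ∀ h, (Rop h : lp (fun _ : X d => ℝ) ∞) = Pop (Aop h))
    (T : lp (fun _ : X d => ℝ) ∞ ≃L[ℝ] (lp (fun _ : X d => ℝ) ∞) × Dop.ker) (hT : ∀ h, T h = (Dop h, Rop h))
    {N : ℝ} (hN0 : 0 ≤ N) (hTN : ∀ y, ‖T.symm y‖ ≤ N * ‖y‖)
    {u₁ u₂ : ℝ → ℝ} {lam δ : ℝ} (hlam : 0 ≤ lam) (hu₂ : ∀ s t, |u₂ s - u₂ t| ≤ lam * |s - t|)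
    {φ₁ φ₂ : lp (fun _ : X d => ℝ) ∞} (hD : Dop φ₁ = Dop φ₂)
    (h₁ : ∀ p : X d, Aop φ₁ p + u₁ (φ₁ p) = (((n : ℝ) + 1) ^ d)⁻¹ * ∑ p' ∈ B n (blk n p), (Aop φ₁ p' + u₁ (φ₁ p')))
    (h₂ : ∀ p : X d, Aop φ₂ p + u₂ (φ₂ p) = (((n : ℝ) + 1) ^ d)⁻¹ * ∑ p' ∈ B n (blk n p), (Aop φ₂ p' + u₂ (φ₂ p')))
    (hδ : ∀ q, |u₂ (φ₁ q) - u₁ (φ₁ q)| ≤ δ) (hsmall : 2 * lam * N < 1) :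
    ‖φ₂ - φ₁‖ ≤ (1 - 2 * lam * N)⁻¹ * (2 * N * δ) := by
  -- sitewise size of `u₂∘φ₂ − u₁∘φ₁`
  have hG : ∀ q, |u₂ (φ₂ q) - u₁ (φ₁ q)| ≤ lam * ‖φ₂ - φ₁‖ + δ := fun q => by
    have h1 := hu₂ (φ₂ q) (φ₁ q)
    have h2 : |φ₂ q - φ₁ q| ≤ ‖φ₂ - φ₁‖ := by
      have h := abs_apply_le_norm (φ₂ - φ₁) q
      rwa [lp.coeFn_sub, Pi.sub_apply] at h
    calc |u₂ (φ₂ q) - u₁ (φ₁ q)| = |(u₂ (φ₂ q) - u₂ (φ₁ q)) + (u₂ (φ₁ q) - u₁ (φ₁ q))| := by ring_nf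
      _ ≤ |u₂ (φ₂ q) - u₂ (φ₁ q)| + |u₂ (φ₁ q) - u₁ (φ₁ q)| := abs_add_le _ _
      _ ≤ lam * ‖φ₂ - φ₁‖ + δ := add_le_add (h1.trans (mul_le_mul_of_nonneg_left h2 hlam)) (hδ q)
  have hPA := norm_fibreProj_A_sub_le hP h₁ h₂ hG
  -- `φ₂ − φ₁ = T⁻¹(0, R(φ₂ − φ₁))`
  have hψ : φ₂ - φ₁ = T.symm (0, Rop (φ₂ - φ₁)) := by
    have h := (ContinuousLinearEquiv.symm_apply_apply T (φ₂ - φ₁)).symm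
    rwa [hT, map_sub Dop, hD, sub_self] at h
  have hnorm : ‖φ₂ - φ₁‖ ≤ N * (2 * (lam * ‖φ₂ - φ₁‖ + δ)) := by
    have h := hTN (0, Rop (φ₂ - φ₁))
    rw [← hψ, Prod.norm_mk, norm_zero, max_eq_right (norm_nonneg _), Submodule.coe_norm, hR] at h
    exact h.trans (mul_le_mul_of_nonneg_left hPA hN0)
  have hpos : 0 < 1 - 2 * lam * N := sub_pos.2 hsmall
  rw [le_inv_mul_iff₀' hpos]
  nlinarith

end Pair

/-! ## §2. (60) for two potentials: the background is Lipschitz in the potential -/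

/-- **THE BACKGROUND IS LIPSCHITZ IN THE POTENTIAL** (`d ≥ 3`, `a > 0`; two sitewise terms `u₁`, `u₂` with (60)'s letters for a
common `(λ, c, N, r)`, `Lip u₁′ ≤ L₁`, `Lip u₂′ ≤ L₂`, and `|u₂ t − u₁ t| ≤ δ` for `|t| ≤ r`): (60)'s operators `Q′, A, P` and the two
backgrounds `σ₁`, `σ₂` with their closed-ball letters and Lipschitz letters exist, AND for every `‖w‖ ≤ (N⁻¹ − c)·r`:
`‖σ₂ w − σ₁ w‖ ≤ (1 − 2λN)⁻¹·2N·δ`. [folklore] -/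
theorem exists_background_pair_modulus (hd : 3 ≤ d) (n : ℕ) {a : ℝ} (ha : 0 < a)
    {u₁ u₁' u₂ u₂' : ℝ → ℝ} (hu₁ : ∀ t, HasDerivAt u₁ (u₁' t) t) (hu₁0 : u₁ 0 = 0) (hu₂ : ∀ t, HasDerivAt u₂ (u₂' t) t)
    (hu₂0 : u₂ 0 = 0) {lam c N : ℝ≥0} (hlam₁ : ∀ t, |u₁' t| ≤ lam) (hlam₂ : ∀ t, |u₂' t| ≤ lam)
    {L₁ L₂ : ℝ} (hL₁0 : 0 ≤ L₁) (hL₁ : ∀ s t, |u₁' s - u₁' t| ≤ L₁ * |s - t|) (hL₂0 : 0 ≤ L₂)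
    (hL₂ : ∀ s t, |u₂' s - u₂' t| ≤ L₂ * |s - t|)
    (hN : cHs d a * latticeConst d (deltaH d a)
        + ((cG0 d * cKL d (d - 2) + cSplit d a) * Real.exp (2 * deltaU d a)
            + cFar d a * Real.exp (4 * deltaU d a) / deltaU d a ^ 2) * latticeConst d (deltaU d a / 4)
          * (1 + cHs d a * latticeConst d (deltaH d a)) ≤ (N : ℝ))
    (hc : 2 * lam ≤ c) (hcN : c < N⁻¹) {r : ℝ} (hr : 0 ≤ r) {δ : ℝ} (hδ : ∀ t, |t| ≤ r → |u₂ t - u₁ t| ≤ δ) :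
    ∃ (Dop Aop Pop : lp (fun _ : X d => ℝ) ∞ →L[ℝ] lp (fun _ : X d => ℝ) ∞)
      (σ₁ σ₂ : lp (fun _ : X d => ℝ) ∞ → lp (fun _ : X d => ℝ) ∞),
      (∀ (f : lp (fun _ : X d => ℝ) ∞) (y : X d), Dop f y = (((n : ℝ) + 1) ^ d)⁻¹ * ∑ p ∈ B n y, f p) ∧
      (∀ (f : lp (fun _ : X d => ℝ) ∞) (p : X d), Aop f p = ∑ r ∈ nbhd n p, AX n a p r * f r) ∧
      (∀ (f : lp (fun _ : X d => ℝ) ∞) (p : X d), Pop f p = f p - (((n : ℝ) + 1) ^ d)⁻¹ * ∑ p' ∈ B n (blk n p), f p') ∧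
      σ₁ 0 = 0 ∧ σ₂ 0 = 0 ∧
      (∀ w ∈ closedBall (0 : lp (fun _ : X d => ℝ) ∞) (((N : ℝ)⁻¹ - c) * r),
        σ₁ w ∈ closedBall 0 r ∧ Dop (σ₁ w) = w ∧
          ∀ p : X d, Aop (σ₁ w) p + u₁ (σ₁ w p)
            = (((n : ℝ) + 1) ^ d)⁻¹ * ∑ p' ∈ B n (blk n p), (Aop (σ₁ w) p' + u₁ (σ₁ w p'))) ∧
      (∀ w ∈ closedBall (0 : lp (fun _ : X d => ℝ) ∞) (((N : ℝ)⁻¹ - c) * r),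
        σ₂ w ∈ closedBall 0 r ∧ Dop (σ₂ w) = w ∧
          ∀ p : X d, Aop (σ₂ w) p + u₂ (σ₂ w p)
            = (((n : ℝ) + 1) ^ d)⁻¹ * ∑ p' ∈ B n (blk n p), (Aop (σ₂ w) p' + u₂ (σ₂ w p'))) ∧
      LipschitzOnWith (N⁻¹ - c)⁻¹ σ₁ (closedBall (0 : lp (fun _ : X d => ℝ) ∞) (((N : ℝ)⁻¹ - c) * r)) ∧
      LipschitzOnWith (N⁻¹ - c)⁻¹ σ₂ (closedBall (0 : lp (fun _ : X d => ℝ) ∞) (((N : ℝ)⁻¹ - c) * r)) ∧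
      ∀ w ∈ closedBall (0 : lp (fun _ : X d => ℝ) ∞) (((N : ℝ)⁻¹ - c) * r),
        ‖σ₂ w - σ₁ w‖ ≤ (1 - 2 * (lam : ℝ) * N)⁻¹ * (2 * N * δ) := by
  obtain ⟨Dop, Aop, Pop, σ₁, hD, hA, hP, hσ₁0, hσ₁, hlip₁, -, -⟩ := exists_background hd n ha hu₁ hu₁0 hlam₁ hL₁0 hL₁ hN hc hcN hr
  obtain ⟨Dop', Aop', Pop', σ₂, hD', hA', hP', hσ₂0, hσ₂, hlip₂, -, -⟩ :=
    exists_background hd n ha hu₂ hu₂0 hlam₂ hL₂0 hL₂ hN hc hcN hr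
  have eD : Dop' = Dop := ContinuousLinearMap.ext fun f => lp.ext (funext fun p => by rw [hD, hD'])
  have eA : Aop' = Aop := ContinuousLinearMap.ext fun f => lp.ext (funext fun p => by rw [hA, hA'])
  have eP : Pop' = Pop := ContinuousLinearMap.ext fun f => lp.ext (funext fun p => by rw [hP, hP'])
  subst eD eA eP
  -- ASE's chart, identified with (60)'s operators
  obtain ⟨Dop'', Aop'', Pop'', hD'', hA'', hP'', -, -, Rop, hR, T, hT, -, hTN⟩ := exists_aug_equiv_sup hd n ha
  have eD : Dop'' = Dop' := ContinuousLinearMap.ext fun f => lp.ext (funext fun p => by rw [hD', hD''])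
  have eA : Aop'' = Aop' := ContinuousLinearMap.ext fun f => lp.ext (funext fun p => by rw [hA', hA''])
  have eP : Pop'' = Pop' := ContinuousLinearMap.ext fun f => lp.ext (funext fun p => by rw [hP', hP''])
  subst eD eA eP
  have hTN' : ∀ y, ‖T.symm y‖ ≤ (N : ℝ) * ‖y‖ := fun y =>
    (hTN y).trans (mul_le_mul_of_nonneg_right hN (norm_nonneg y))
  have hsmall : 2 * (lam : ℝ) * N < 1 := by
    have h1 : (2 * lam : ℝ≥0) * N ≤ c * N := mul_le_mul_of_nonneg_right hc N.2
    have h2 : c * N < 1 := by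
      have hNpos : 0 < N := by
        have : (0 : ℝ≥0) ≤ c := c.2
        exact pos_of_gt ((inv_pos.mp (lt_of_le_of_lt this hcN |> fun h => by simpa using h)))
      calc c * N < N⁻¹ * N := mul_lt_mul_of_pos_right hcN hNpos
        _ = 1 := inv_mul_cancel₀ hNpos.ne'
    have h3 := lt_of_le_of_lt h1 h2
    exact_mod_cast h3
  have hul : ∀ s t, |u₂ s - u₂ t| ≤ (lam : ℝ) * |s - t| := fun s t => by
    have hderiv : ∀ x ∈ uIcc t s, HasDerivWithinAt u₂ (u₂' x) (uIcc t s) x := fun x _ => (hu₂ x).hasDerivWithinAt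
    have hbound : ∀ x ∈ uIcc t s, ‖u₂' x‖ ≤ lam := fun x _ => by rw [Real.norm_eq_abs]; exact hlam₂ x
    have h := Convex.norm_image_sub_le_of_norm_hasDerivWithin_le hderiv hbound (convex_uIcc t s) left_mem_uIcc right_mem_uIcc
    rwa [Real.norm_eq_abs, Real.norm_eq_abs] at h
  refine ⟨Dop'', Aop'', Pop'', σ₁, σ₂, hD, hA, hP, hσ₁0, hσ₂0, hσ₁, hσ₂, hlip₁, hlip₂, fun w hw => ?_⟩
  obtain ⟨hb₁, hD₁, hE₁⟩ := hσ₁ w hw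
  obtain ⟨-, hD₂, hE₂⟩ := hσ₂ w hw
  rw [mem_closedBall, dist_zero_right] at hb₁
  exact norm_sub_le_of_background_pair hP Rop hR T hT N.2 hTN' lam.2 hul (hD₁.trans hD₂.symm) hE₁ hE₂
    (fun q => hδ _ ((abs_apply_le_norm (σ₁ w) q).trans hb₁)) hsmall

/-! ## §3. The soft weight `a` is a gauge for the hard background -/

/-- **THE SITEWISE SYSTEM DOES NOT SEE THE WEIGHT**: for every field `φ : ℤ^d → ℝ`, if `A_{a′}φ + u∘φ` is block-constant then so is
`A_aφ + u∘φ` — the two site matrices differ by `(a − a′)(n+1)^{−d}Σ_{B(blk p)}φ = (a − a′)·(Q′φ)(blk p)`, a block-constant field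
((76) `sum_nbhd_AX_mul`). [folklore] -/
theorem backgroundSystem_of_weight (n : ℕ) (a a' : ℝ) (u : ℝ → ℝ) (φ : X d → ℝ)
    (h : ∀ p : X d, (∑ r ∈ nbhd n p, AX n a' p r * φ r) + u (φ p)
      = (((n : ℝ) + 1) ^ d)⁻¹ * ∑ p' ∈ B n (blk n p), ((∑ r ∈ nbhd n p', AX n a' p' r * φ r) + u (φ p'))) (p : X d) :
    (∑ r ∈ nbhd n p, AX n a p r * φ r) + u (φ p)
      = (((n : ℝ) + 1) ^ d)⁻¹ * ∑ p' ∈ B n (blk n p), ((∑ r ∈ nbhd n p', AX n a p' r * φ r) + u (φ p')) := by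
  -- the `a`-system's left side is the `a′`-system's left side plus a block-constant field
  have key : ∀ q : X d, (∑ r ∈ nbhd n q, AX n a q r * φ r) + u (φ q)
      = ((∑ r ∈ nbhd n q, AX n a' q r * φ r) + u (φ q))
        + (fun z : X d => (a - a') / ((n : ℝ) + 1) ^ d * ∑ r ∈ B n z, φ r) (blk n q) := fun q => by
    rw [sum_nbhd_AX_mul, sum_nbhd_AX_mul]
    ring
  obtain ⟨F, hF⟩ : ∃ F : X d → ℝ, ∀ q, (∑ r ∈ nbhd n q, AX n a' q r * φ r) + u (φ q) = F (blk n q) :=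
    ⟨fun y => (((n : ℝ) + 1) ^ d)⁻¹ * ∑ p' ∈ B n y, ((∑ r ∈ nbhd n p', AX n a' p' r * φ r) + u (φ p')), h⟩
  have key' : ∀ q : X d, (∑ r ∈ nbhd n q, AX n a q r * φ r) + u (φ q)
      = (fun z : X d => F z + (a - a') / ((n : ℝ) + 1) ^ d * ∑ r ∈ B n z, φ r) (blk n q) := fun q => by
    rw [key q, hF q]
  rw [Finset.sum_congr rfl fun p' _ => key' p',
    blockAvg_comp_blk n (fun z : X d => F z + (a - a') / ((n : ℝ) + 1) ^ d * ∑ r ∈ B n z, φ r) (blk n p)]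
  exact key' p

/-- **THE HARD BACKGROUND DOES NOT DEPEND ON THE SOFT WEIGHT**: under the displayed actions of the site matrices at weights `a` and
`a′` and `σ_a`'s uniqueness clause at radius `r` ((60) for `(a, u)`), every `φ ∈ ℓ^∞` with `‖φ‖ ≤ r` solving the sitewise system for
`(a′, u)` — in particular `σ_{a′}(w)` — satisfies `σ_a(Q′φ) = φ`; so `σ_a w = σ_{a′} w` wherever both closed-ball letters hold. [folklore] -/
theorem background_indep_of_weight (n : ℕ) {a a' : ℝ}
    (Dop Aop Aop' : lp (fun _ : X d => ℝ) ∞ →L[ℝ] lp (fun _ : X d => ℝ) ∞) (σ : lp (fun _ : X d => ℝ) ∞ → lp (fun _ : X d => ℝ) ∞)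
    (hA : ∀ (f : lp (fun _ : X d => ℝ) ∞) (p : X d), Aop f p = ∑ r ∈ nbhd n p, AX n a p r * f r)
    (hA' : ∀ (f : lp (fun _ : X d => ℝ) ∞) (p : X d), Aop' f p = ∑ r ∈ nbhd n p, AX n a' p r * f r)
    {u : ℝ → ℝ} {r : ℝ}
    (huniq : ∀ φ ∈ closedBall (0 : lp (fun _ : X d => ℝ) ∞) r,
      (∀ p : X d, Aop φ p + u (φ p) = (((n : ℝ) + 1) ^ d)⁻¹ * ∑ p' ∈ B n (blk n p), (Aop φ p' + u (φ p'))) →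
        σ (Dop φ) = φ)
    {φ : lp (fun _ : X d => ℝ) ∞} (hφ : φ ∈ closedBall (0 : lp (fun _ : X d => ℝ) ∞) r)
    (hsys : ∀ p : X d, Aop' φ p + u (φ p) = (((n : ℝ) + 1) ^ d)⁻¹ * ∑ p' ∈ B n (blk n p), (Aop' φ p' + u (φ p'))) :
    σ (Dop φ) = φ := by
  refine huniq φ hφ fun p => ?_
  simp only [hA]
  refine backgroundSystem_of_weight n a a' u (fun q => φ q) (fun q => ?_) p
  have h := hsys q
  simp only [hA'] at h
  exact h

/-! ## §4. Toy -/

/-- Toy: the modulus constant — with `N = 2`, `λ = 1∕10` (`2λN = 2∕5 < 1`) a potential change of `δ = 1∕100` on `[−r, r]` moves the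
background by at most `(1 − 2∕5)⁻¹·(2·2·(1∕100)) = 1∕15` in the sup norm. -/
example : (1 - 2 * (1 / 10 : ℝ) * 2)⁻¹ * (2 * 2 * (1 / 100)) = 1 / 15 := by norm_num

end Summit.QuantumFields.BalabanUV.T4Continuum.NE7b.SupBackgroundDataModulus

end
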